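import Literature.AlgebraicGeometry.Motives.MixedHodgeStructureSocleHodgeClasses
import Literature.AlgebraicGeometry.Motives.MixedHodgeExtensionSplitOverQ
import HarnessLib

/-!
# Semisimple mixed Hodge structures: every monomorphism retracts, every epimorphism has a section

Semisimplicity of an object of the abelian category of MHS (Cattani–El Zein–Griffiths–Lê, *Hodge Theory*,
Thm. 3.2.18; "direct sum of simple objects", p. 270; the tree's `MixedHodgeStructure.IsSemisimple`: every
sub-MHS has a complementary sub-MHS) in the language of morphisms and of Carlson's extensions (§2(b): "an
extension which admits a section is split"): **`H` is semisimple iff every `0 → S → H → H/S → 0` splits, iff every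
sub-MHS inclusion has a retraction, iff every quotient map has a section**; morphisms INTO a semisimple `H` that are
injective retract, morphisms OUT of it that are surjective have sections. For an arbitrary extension
`0 → B → E → A → 0`: **`E` is semisimple iff it splits and `A`, `B` are semisimple** — with no separation or
polarizability hypothesis (the tree's `Extension.isSemisimple_iff_isSplit` assumed both; CEGL Ch. 12 footnote 2,
p. 527: the `ℚ`-split MHS are those with "no nontrivial extensions").
Namespace `MixedHodgeStructure`; everything proved, no named facts.

## References

* [CattaniElZeinGriffithsLe2014] E. Cattani et al. (eds.), Hodge Theory (2014), Thm. 3.2.18, p. 270, Ch. 12 fn. 2 (p. 527).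
* [Carlson1980] J. Carlson, Extensions of mixed Hodge structures (Angers 1979), §2(b).
-/

noncomputable section

namespace Literature.AlgebraicGeometry.Motives

namespace MixedHodgeStructure

universe u v w

variable {V : Type u} [AddCommGroup V] [Module ℚ V]
variable {V' : Type v} [AddCommGroup V'] [Module ℚ V']
variable {V'' : Type w} [AddCommGroup V''] [Module ℚ V'']
variable {H : MixedHodgeStructure V} {H' : MixedHodgeStructure V'} {H'' : MixedHodgeStructure V''}

/-! ### §1 Semisimple iff all sub-MHS sequences split -/

/-- **`H` is semisimple iff `0 → S → H → H/S → 0` splits for every sub-MHS `S`** (a splitting's image is a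
complement, and conversely). [cite: Carlson1980, §2(b)] [cite: CattaniElZeinGriffithsLe2014, Thm. 3.2.18 and p. 270] -/
theorem isSemisimple_iff_forall_extension_isSplit :
    H.IsSemisimple ↔ ∀ S : SubMixedHodgeStructure H, S.extension.IsSplit :=
  ⟨fun h S => S.isSplit_extension_iff_exists_isCompl.2 (h S), fun h S => S.isSplit_extension_iff_exists_isCompl.1 (h S)⟩

/-! ### §2 Retractions of monomorphisms, sections of epimorphisms -/

/-- **An injective morphism into a semisimple MHS has a retraction** (project onto its image along a complementary
sub-MHS, then invert `H' ⥲ Im f`). [cite: CattaniElZeinGriffithsLe2014, Thm. 3.2.18 and p. 270] [cite: Carlson1980, §2(b)] -/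
theorem IsSemisimple.exists_retraction (h : H.IsSemisimple) (f : Hom H' H) (hf : Function.Injective f.toLinearMap) :
    ∃ r : Hom H H', r.comp f = Hom.id H' := by
  obtain ⟨T, hT⟩ := h f.range
  have hb := f.rangeRestrict_bijective_of_injective hf
  refine ⟨(f.rangeRestrict.inverse hb).comp (SubMixedHodgeStructure.projOfIsCompl T f.range hT.symm),
    Hom.ext (LinearMap.ext fun x => ?_)⟩
  change (f.rangeRestrict.inverse hb).toLinearMap
      ((SubMixedHodgeStructure.projOfIsCompl T f.range hT.symm).toLinearMap
        ((f.rangeRestrict.toLinearMap x : ↥f.range.toSubmodule) : V)) = x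
  rw [SubMixedHodgeStructure.projOfIsCompl_apply_of_mem_right, ← LinearMap.comp_apply, ← Hom.comp_toLinearMap,
    Hom.inverse_comp]
  rfl

/-- **A surjective morphism out of a semisimple MHS has a section.** [cite: CattaniElZeinGriffithsLe2014, Thm. 3.2.18 and p. 270]
[cite: Carlson1980, §2(b)] -/
theorem IsSemisimple.exists_section (h : H.IsSemisimple) (g : Hom H H'') (hg : Function.Surjective g.toLinearMap) :
    ∃ s : Hom H'' H, g.comp s = Hom.id H'' := by
  obtain ⟨T, hT⟩ := h g.ker
  obtain ⟨s, hs⟩ := g.exists_section_of_isCompl_ker T hT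
  have hb : Function.Bijective g.range.subtype.toLinearMap :=
    ⟨Submodule.injective_subtype _, fun y =>
      ⟨⟨y, by rw [Hom.range_toSubmodule, LinearMap.range_eq_top.2 hg]; trivial⟩, rfl⟩⟩
  refine ⟨s.comp (g.range.subtype.inverse hb), Hom.ext ?_⟩
  rw [Hom.comp_toLinearMap, Hom.comp_toLinearMap, ← LinearMap.comp_assoc, hs]
  change (g.range.subtype.comp (g.range.subtype.inverse hb)).toLinearMap = _
  rw [Hom.comp_inverse]

/-- **`H` is semisimple iff every sub-MHS inclusion `S ↪ H` has a retraction** (the kernel of a retraction is a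
complement). [cite: CattaniElZeinGriffithsLe2014, Thm. 3.2.18 and p. 270] [cite: Carlson1980, §2(b)] -/
theorem isSemisimple_iff_forall_exists_retraction :
    H.IsSemisimple ↔ ∀ S : SubMixedHodgeStructure H, ∃ r : Hom H S.toMixedHodgeStructure, r.comp S.subtype = Hom.id _ := by
  refine ⟨fun h S => h.exists_retraction S.subtype (Submodule.injective_subtype _), fun h S => ?_⟩
  obtain ⟨r, hr⟩ := h S
  refine ⟨r.ker, ?_⟩
  rw [Hom.ker_toSubmodule]
  exact LinearMap.isCompl_of_proj fun x => by
    change (r.comp S.subtype).toLinearMap x = x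
    rw [hr]
    rfl

/-- **`H` is semisimple iff every quotient map `H ↠ H/S` has a section.** [cite: CattaniElZeinGriffithsLe2014, Thm. 3.2.18 and p. 270]
[cite: Carlson1980, §2(b)] -/
theorem isSemisimple_iff_forall_exists_section :
    H.IsSemisimple ↔ ∀ S : SubMixedHodgeStructure H, ∃ s : Hom S.quotient H, S.mkQ.comp s = Hom.id _ := by
  refine ⟨fun h S => h.exists_section S.mkQ (Submodule.mkQ_surjective _), fun h S => ?_⟩
  obtain ⟨s, hs⟩ := h S
  exact S.isSplit_extension_iff_exists_isCompl.1 ⟨⟨s, congrArg Hom.toLinearMap hs⟩⟩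

/-- A retraction of `S ↪ H` for semisimple `H`. [cite: CattaniElZeinGriffithsLe2014, Thm. 3.2.18 and p. 270] -/
theorem IsSemisimple.exists_retraction_subtype (h : H.IsSemisimple) (S : SubMixedHodgeStructure H) :
    ∃ r : Hom H S.toMixedHodgeStructure, r.comp S.subtype = Hom.id _ :=
  h.exists_retraction S.subtype (Submodule.injective_subtype _)

/-- A section of `H ↠ H/S` for semisimple `H`. [cite: CattaniElZeinGriffithsLe2014, Thm. 3.2.18 and p. 270] -/
theorem IsSemisimple.exists_section_mkQ (h : H.IsSemisimple) (S : SubMixedHodgeStructure H) :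
    ∃ s : Hom S.quotient H, S.mkQ.comp s = Hom.id _ :=
  h.exists_section S.mkQ (Submodule.mkQ_surjective _)

/-! ### §3 Extensions: semisimple middle iff split with semisimple ends -/

namespace Extension

variable {VA : Type u} [AddCommGroup VA] [Module ℚ VA]
variable {VB : Type v} [AddCommGroup VB] [Module ℚ VB]
variable {VE : Type w} [AddCommGroup VE] [Module ℚ VE]
variable {A : MixedHodgeStructure VA} {B : MixedHodgeStructure VB} (E : Extension A B VE)

/-- A section of `π : E → A` is injective. [cite: Carlson1980, §2(b)] -/
theorem sec_injective (sp : E.Splitting) : Function.Injective sp.sec.toLinearMap := fun x y hxy => by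
  have h := congrArg E.proj.toLinearMap hxy
  rwa [← LinearMap.comp_apply, sp.proj_comp, ← LinearMap.comp_apply, sp.proj_comp] at h

/-- **A split extension of semisimple MHS has semisimple middle** (`E ≅ i(B) ⊕ s(A)` with both summands semisimple).
[cite: CattaniElZeinGriffithsLe2014, Thm. 3.2.18 and p. 270] [cite: Carlson1980, §2(b)] -/
theorem IsSplit.isSemisimple_mhs {E : Extension A B VE} (hs : E.IsSplit) (hA : A.IsSemisimple) (hB : B.IsSemisimple) :
    E.mhs.IsSemisimple := by
  obtain ⟨sp⟩ := hs
  exact IsSemisimple.of_isCompl E.inc.range sp.sec.range (E.isCompl_range_inc_range_sec sp)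
    (hB.range_of_injective E.inc E.injective_inc) (hA.range_of_injective sp.sec (E.sec_injective sp))

/-- **An extension with semisimple middle splits** (a section of `π` exists) — no separation hypothesis (compare the
tree's `isSplit_of_isSemisimple`). [cite: CattaniElZeinGriffithsLe2014, Thm. 3.2.18 and p. 270] [cite: Carlson1980, §2(b)] -/
theorem isSplit_of_isSemisimple_mhs (h : E.mhs.IsSemisimple) : E.IsSplit := by
  obtain ⟨s, hs⟩ := h.exists_section E.proj E.surjective_proj
  exact ⟨⟨s, congrArg Hom.toLinearMap hs⟩⟩

/-- **The middle of `0 → B → E → A → 0` is semisimple iff the extension splits and `A`, `B` are semisimple.**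
[cite: CattaniElZeinGriffithsLe2014, Thm. 3.2.18, p. 270 and Ch. 12 footnote 2 (p. 527)] [cite: Carlson1980, §2(b)] -/
theorem isSemisimple_mhs_iff [FiniteDimensional ℚ VA] [FiniteDimensional ℚ VE] :
    E.mhs.IsSemisimple ↔ E.IsSplit ∧ A.IsSemisimple ∧ B.IsSemisimple :=
  ⟨fun h => ⟨E.isSplit_of_isSemisimple_mhs h, E.isSemisimple_right h, E.isSemisimple_left h⟩,
    fun h => h.1.isSemisimple_mhs h.2.1 h.2.2⟩

/-- A non-split extension has a non-semisimple middle. [cite: Carlson1980, §2(b)] -/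
theorem not_isSemisimple_mhs_of_not_isSplit (h : ¬E.IsSplit) : ¬E.mhs.IsSemisimple :=
  fun hs => h (E.isSplit_of_isSemisimple_mhs hs)

end Extension

end MixedHodgeStructure

end Literature.AlgebraicGeometry.Motives
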